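import Summits.HubbardSuperconductivity.HubbardSuperconductivity.Theorems.AnisotropyChordInsertionEntropyRoute
import Mathlib.Analysis.MeanInequalities

/-!
# Route `AnisotropyChord` / H0 rotor rung: THE PARTICLE-NUMBER TOWER — raising operator, adjointness, commutator gain,
# one-step ladder (port of theory seat `hubbard-h0-rotor-theory-1`, cycle 11, `Sketch11.lean` Part A, memo ROTOR-THEORY-11
# §148–§149; work-order v11a)

Hard-core bosons on a finite vertex set `V` (spin ½; particle at `x` ⇔ `σ x = 0`; tree vocabulary of
`…InsertionEntropyRoute`: `lowerSum a = S⁻_tot a = B a`, `lowerNormSq a = ‖B a‖²`, `condensateDensity a = ‖B a‖²/|V|²`,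
`towerSum b a = ⟨b, B a⟩`).  The RAISING side `raiseSum b = B† b`, the adjointness `⟨c, B a⟩ = ⟨B† c, a⟩`
(`sum_mul_lowerSum_eq_sum_raiseSum_mul`), the pointwise commutator `B B† − B† B = (#holes − #particles)`
(`commutator_pointwise`), the **COMMUTATOR GAIN** `‖B† b‖² = ‖B b‖² + (|V| − 2n)‖b‖²` on `n`-particle amplitudes
(`raiseNormSq_eq_lowerNormSq_add`), the **TOWER FIDELITY** `Z(b → a) = ⟨a, B† b⟩²/‖B† b‖²`, the **ONE-STEP LADDER**
`‖B a‖² ≥ Z(b → a)·(‖B b‖² + |V| − 2n)` (`lowerNormSq_succ_ge`, `condensateDensity_succ_ge`) and the removal fidelity.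
Nearest prior art: Koma–Tasaki 1994 / Tasaki 2018 (arXiv:1807.05847, Thm. 3.1).  Typing/proof authority: theory seat.
-/

set_option linter.dupNamespace false
set_option autoImplicit false

noncomputable section

open Finset Filter Topology
open Summit.HubbardSuperconductivity.HubbardSuperconductivity.Theorems.AnisotropyChord.InsertionEntropy
open Literature.MathematicalPhysics.QuantumLattice Literature.Probability.LatticeModels

namespace Summit.HubbardSuperconductivity.HubbardSuperconductivity.Theorems.AnisotropyChord.Tower

/-! ## Part A — raising operator, adjointness, commutator gain, one-step ladder -/

section Lattice

variable {V : Type} [Fintype V] [DecidableEq V]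

/-- Every element of `Fin 2` is `0` or `1`. [folklore] -/
private theorem fin2_cases (i : Fin 2) : i = 0 ∨ i = 1 := by
  rcases i with ⟨_ | _ | k, hk⟩
  · left; rfl
  · right; rfl
  · omega

/-- `1 − (1 − i) = i` in `Fin 2`. [folklore] -/
private theorem fin2_one_sub_one_sub (i : Fin 2) : (1 : Fin 2) - (1 - i) = i := by
  rcases fin2_cases i with h | h <;> subst h <;> decide

/-- Flip of the occupation at `x`. [folklore] -/
def flipAt (x : V) (σ : V → Fin 2) : V → Fin 2 := Function.update σ x (1 - σ x)

omit [Fintype V] in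
/-- Flipping twice is the identity. [folklore] -/
theorem flipAt_flipAt (x : V) (σ : V → Fin 2) : flipAt x (flipAt x σ) = σ := by
  funext y
  by_cases h : y = x
  · subst h; simp [flipAt]
  · simp [flipAt, h]

omit [Fintype V] in
/-- Flipping a particle gives a hole. [folklore] -/
theorem flipAt_of_eq_zero {x : V} {σ : V → Fin 2} (h : σ x = 0) : flipAt x σ = Function.update σ x 1 := by
  simp [flipAt, h]

omit [Fintype V] in
/-- Flipping a hole gives a particle. [folklore] -/
theorem flipAt_of_eq_one {x : V} {σ : V → Fin 2} (h : σ x = 1) : flipAt x σ = Function.update σ x 0 := by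
  simp [flipAt, h]

/-- `flipAt x` as an equivalence (an involution). [folklore] -/
def flipEquiv (x : V) : (V → Fin 2) ≃ (V → Fin 2) :=
  ⟨flipAt x, flipAt x, flipAt_flipAt x, flipAt_flipAt x⟩

/-- Reindexing a configuration sum by the flip at `x`. [folklore] -/
theorem sum_flip (x : V) (f : (V → Fin 2) → ℝ) : ∑ σ, f σ = ∑ σ, f (flipAt x σ) :=
  (Equiv.sum_comp (flipEquiv x) f).symm

/-- `(S⁺_tot b)(σ) = (B† b)(σ) = Σ_{x : σ x = 0} b(σ with x ↦ 1)` (`b†_x` adds the particle at `x`). [folklore] -/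
def raiseSum (b : (V → Fin 2) → ℝ) (σ : V → Fin 2) : ℝ :=
  ∑ x, if σ x = 0 then b (Function.update σ x 1) else 0

/-- `‖B† b‖² = Σ_{x,y} ⟨b, b_x b†_y b⟩`. [folklore] -/
def raiseNormSq (b : (V → Fin 2) → ℝ) : ℝ := ∑ σ, raiseSum b σ ^ 2

/-- **ADJOINTNESS** `⟨c, B a⟩ = ⟨B† c, a⟩`:  `Σ_τ c(τ) (B a)(τ) = Σ_σ (B† c)(σ) a(σ)` for ALL real functions. [folklore] -/
theorem sum_mul_lowerSum_eq_sum_raiseSum_mul (a c : (V → Fin 2) → ℝ) :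
    ∑ τ, c τ * lowerSum a τ = ∑ σ, raiseSum c σ * a σ := by
  unfold lowerSum raiseSum
  simp_rw [Finset.mul_sum, Finset.sum_mul]
  rw [Finset.sum_comm]
  conv_rhs => rw [Finset.sum_comm]
  refine Finset.sum_congr rfl fun x _ => ?_
  rw [sum_flip x (fun σ => (if σ x = 0 then c (Function.update σ x 1) else 0) * a σ)]
  refine Finset.sum_congr rfl fun τ _ => ?_
  rcases fin2_cases (τ x) with h | h
  · -- τ x = 0 : both sides vanish
    have h1 : flipAt x τ x = 1 := by simp [flipAt, h]
    simp [h, h1]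
  · have h0 : flipAt x τ x = 0 := by simp [flipAt, h]
    have hupd : Function.update (flipAt x τ) x 1 = τ := by
      rw [flipAt, Function.update_idem, ← h, Function.update_eq_self]
    rw [flipAt_of_eq_one h] at h0 hupd ⊢
    simp only [h, if_true, h0, hupd]

/-- The MOVE sum `Σ_{x particle, y hole} b(ν with the particle moved from x to y)`. [folklore] -/
def moveSum (b : (V → Fin 2) → ℝ) (ν : V → Fin 2) : ℝ :=
  ∑ x, ∑ y, if ν x = 0 ∧ ν y = 1 then b (Function.update (Function.update ν x 1) y 0) else 0

omit [DecidableEq V] in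
/-- Pull a conditional through a finite sum. [folklore] -/
private theorem ite_sum_zero (P : Prop) [Decidable P] (f : V → ℝ) :
    (if P then ∑ x, f x else 0) = ∑ x, (if P then f x else 0) := by
  split_ifs <;> simp

/-- `(B B† b)(ν) = #holes(ν) · b(ν) + moveSum b ν`. [folklore] -/
theorem lowerSum_raiseSum (b : (V → Fin 2) → ℝ) (ν : V → Fin 2) :
    lowerSum (raiseSum b) ν = ((univ.filter fun y => ν y = 1).card : ℝ) * b ν + moveSum b ν := by
  unfold lowerSum raiseSum moveSum
  -- push the outer `ite` inside and split every summand into a diagonal and a move part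
  have hsplit : ∀ y x : V,
      (if ν y = 1 then (if Function.update ν y 0 x = 0 then b (Function.update (Function.update ν y 0) x 1)
        else 0) else 0)
      = (if x = y then (if ν y = 1 then b ν else 0) else 0)
        + (if ν x = 0 ∧ ν y = 1 then b (Function.update (Function.update ν x 1) y 0) else 0) := by
    intro y x
    by_cases hxy : x = y
    · subst hxy
      by_cases hy : ν x = 1
      · have hupd : Function.update (Function.update ν x 0) x 1 = ν := by
          rw [Function.update_idem, ← hy, Function.update_eq_self]
        simp [hy, hupd]
      · simp [hy]
    · by_cases hy : ν y = 1
      · by_cases hx : ν x = 0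
        · have hcomm : Function.update (Function.update ν y 0) x 1
              = Function.update (Function.update ν x 1) y 0 := (Function.update_comm hxy _ _ _).symm
          simp [hy, hx, hxy, hcomm]
        · simp [hy, hx, hxy]
      · simp [hy, hxy]
  simp_rw [ite_sum_zero]
  simp_rw [hsplit, Finset.sum_add_distrib]
  congr 1
  · simp_rw [Finset.sum_ite_eq' univ, Finset.mem_univ, if_true]
    rw [Finset.sum_ite, Finset.sum_const_zero, add_zero, Finset.sum_const, nsmul_eq_mul]
  · rw [Finset.sum_comm]

/-- `(B† B b)(ν) = #particles(ν) · b(ν) + moveSum b ν`. [folklore] -/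
theorem raiseSum_lowerSum (b : (V → Fin 2) → ℝ) (ν : V → Fin 2) :
    raiseSum (lowerSum b) ν = ((univ.filter fun x => ν x = 0).card : ℝ) * b ν + moveSum b ν := by
  unfold lowerSum raiseSum moveSum
  have hsplit : ∀ x y : V,
      (if ν x = 0 then (if Function.update ν x 1 y = 1 then b (Function.update (Function.update ν x 1) y 0)
        else 0) else 0)
      = (if y = x then (if ν x = 0 then b ν else 0) else 0)
        + (if ν x = 0 ∧ ν y = 1 then b (Function.update (Function.update ν x 1) y 0) else 0) := by
    intro x y
    by_cases hxy : y = x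
    · subst hxy
      by_cases hx : ν y = 0
      · have hupd : Function.update (Function.update ν y 1) y 0 = ν := by
          rw [Function.update_idem, ← hx, Function.update_eq_self]
        simp [hx, hupd]
      · simp [hx]
    · by_cases hx : ν x = 0
      · by_cases hy : ν y = 1
        · simp [hy, hx, hxy]
        · simp [hy, hx, hxy]
      · simp [hx, hxy]
  simp_rw [ite_sum_zero]
  simp_rw [hsplit, Finset.sum_add_distrib]
  congr 1
  simp_rw [Finset.sum_ite_eq' univ, Finset.mem_univ, if_true]
  rw [Finset.sum_ite, Finset.sum_const_zero, add_zero, Finset.sum_const, nsmul_eq_mul]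

/-- **POINTWISE COMMUTATOR** `(B B† − B† B) b = (#holes − #particles) · b`
(hard-core bosons: `[b_x, b†_y] = δ_{xy}(1 − 2n_x)`). [folklore] -/
theorem commutator_pointwise (b : (V → Fin 2) → ℝ) (ν : V → Fin 2) :
    lowerSum (raiseSum b) ν - raiseSum (lowerSum b) ν
      = (((univ.filter fun y => ν y = 1).card : ℝ) - ((univ.filter fun x => ν x = 0).card : ℝ)) * b ν := by
  rw [lowerSum_raiseSum, raiseSum_lowerSum]; ring

omit [DecidableEq V] in
/-- `#holes + #particles = |V|`. [folklore] -/
theorem card_holes_add_card_particles (ν : V → Fin 2) :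
    ((univ.filter fun y => ν y = 1).card : ℝ) + ((univ.filter fun x => ν x = 0).card : ℝ)
      = (Fintype.card V : ℝ) := by
  have h := Finset.card_filter_add_card_filter_not (s := (univ : Finset V)) (fun y => ν y = 1)
  have hneg : (univ.filter fun x => ¬ ν x = 1) = (univ.filter fun x => ν x = 0) := by
    ext x
    simp only [Finset.mem_filter, Finset.mem_univ, true_and]
    rcases fin2_cases (ν x) with hx | hx <;> simp [hx]
  rw [hneg, Finset.card_univ] at h
  exact_mod_cast h

/-- `‖B† b‖² = ⟨b, B B† b⟩`. [folklore] -/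
theorem raiseNormSq_eq (b : (V → Fin 2) → ℝ) : raiseNormSq b = ∑ ν, b ν * lowerSum (raiseSum b) ν := by
  unfold raiseNormSq
  rw [sum_mul_lowerSum_eq_sum_raiseSum_mul]
  simp [sq]

/-- `‖B b‖² = ⟨b, B† B b⟩`. [folklore] -/
theorem lowerNormSq_eq (b : (V → Fin 2) → ℝ) : lowerNormSq b = ∑ ν, b ν * raiseSum (lowerSum b) ν := by
  unfold lowerNormSq
  have h := sum_mul_lowerSum_eq_sum_raiseSum_mul b (lowerSum b)
  simp_rw [sq]
  rw [h]
  exact Finset.sum_congr rfl fun ν _ => mul_comm _ _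

/-- **COMMUTATOR GAIN.**  For an amplitude supported on `n`-particle configurations,
`‖B† b‖² = ‖B b‖² + (|V| − 2n) ‖b‖²`. [folklore] -/
theorem raiseNormSq_eq_lowerNormSq_add (b : (V → Fin 2) → ℝ) (n : ℝ)
    (hsupp : ∀ ν, b ν ≠ 0 → ((univ.filter fun x => ν x = 0).card : ℝ) = n) :
    raiseNormSq b = lowerNormSq b + ((Fintype.card V : ℝ) - 2 * n) * ∑ ν, b ν ^ 2 := by
  rw [raiseNormSq_eq, lowerNormSq_eq, Finset.mul_sum, ← Finset.sum_add_distrib]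
  refine Finset.sum_congr rfl fun ν _ => ?_
  by_cases hb : b ν = 0
  · simp [hb]
  · have hc := commutator_pointwise b ν
    have hV := card_holes_add_card_particles ν
    have hn : ((univ.filter fun x => ν x = 0).card : ℝ) = n := hsupp ν hb
    rw [hn] at hc hV
    have h1 : ((univ.filter fun y => ν y = 1).card : ℝ) = (Fintype.card V : ℝ) - n := by linarith
    rw [h1] at hc
    have : lowerSum (raiseSum b) ν = raiseSum (lowerSum b) ν + ((Fintype.card V : ℝ) - 2 * n) * b ν := by
      linear_combination hc
    rw [this]; ring

/-- **TOWER FIDELITY** `Z(b → a) = ⟨a, B† b⟩² / ‖B† b‖²` (= `cos²` of the angle between `B† b` and the unit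
vector `a`; junk `0` when `B† b = 0`). [folklore] -/
def towerFidelity (b a : (V → Fin 2) → ℝ) : ℝ := towerSum b a ^ 2 / raiseNormSq b

/-- `⟨b, B a⟩ = ⟨B† b, a⟩`. [folklore] -/
theorem towerSum_eq_raise (b a : (V → Fin 2) → ℝ) : towerSum b a = ∑ σ, raiseSum b σ * a σ :=
  sum_mul_lowerSum_eq_sum_raiseSum_mul a b

/-- The tower fidelity is non-negative. [folklore] -/
theorem towerFidelity_nonneg (b a : (V → Fin 2) → ℝ) : 0 ≤ towerFidelity b a := by
  unfold towerFidelity raiseNormSq; positivity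

/-- `Z ≤ ‖a‖²` (Cauchy–Schwarz); in particular `Z ≤ 1` for a unit `a`. [folklore] -/
theorem towerFidelity_le (b a : (V → Fin 2) → ℝ) : towerFidelity b a ≤ ∑ σ, a σ ^ 2 := by
  unfold towerFidelity
  have hcs : towerSum b a ^ 2 ≤ raiseNormSq b * ∑ σ, a σ ^ 2 := by
    rw [towerSum_eq_raise]; unfold raiseNormSq
    exact Finset.sum_mul_sq_le_sq_mul_sq univ (raiseSum b) a
  rcases eq_or_lt_of_le (show 0 ≤ raiseNormSq b by unfold raiseNormSq; positivity) with h | h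
  · rw [← h]; simp; positivity
  · rw [div_le_iff₀ h]; linarith

/-- `⟨a, B† b⟩² = Z · ‖B† b‖²` (also in the junk case). [folklore] -/
theorem towerSum_sq_eq (b a : (V → Fin 2) → ℝ) : towerSum b a ^ 2 = towerFidelity b a * raiseNormSq b := by
  unfold towerFidelity
  rcases eq_or_lt_of_le (show 0 ≤ raiseNormSq b by unfold raiseNormSq; positivity) with h | h
  · -- ‖B† b‖ = 0 ⇒ B† b = 0 ⇒ ⟨a, B† b⟩ = 0
    have hz : ∀ σ, raiseSum b σ = 0 := by
      intro σ
      have := (Finset.sum_eq_zero_iff_of_nonneg (fun σ _ => sq_nonneg (raiseSum b σ))).1 h.symm σ (mem_univ σ)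
      exact pow_eq_zero_iff (n := 2) (by norm_num) |>.1 this
    rw [towerSum_eq_raise]; simp [hz]
  · field_simp

/-- **ONE-STEP LADDER.**  `b` a unit amplitude on `n`-particle configurations, `a` arbitrary (the
`(n+1)`-particle state): `‖B a‖² ≥ Z(b → a) · (‖B b‖² + |V| − 2n)`. [folklore] -/
theorem lowerNormSq_succ_ge (b a : (V → Fin 2) → ℝ) (n : ℝ) (hunit : ∑ ν, b ν ^ 2 = 1)
    (hsupp : ∀ ν, b ν ≠ 0 → ((univ.filter fun x => ν x = 0).card : ℝ) = n) :
    towerFidelity b a * (lowerNormSq b + ((Fintype.card V : ℝ) - 2 * n)) ≤ lowerNormSq a := by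
  have hgain := raiseNormSq_eq_lowerNormSq_add b n hsupp
  rw [hunit, mul_one] at hgain
  rw [← hgain, ← towerSum_sq_eq]
  have := towerSum_sq_le b a
  rw [hunit, one_mul] at this
  exact this

/-- The same in condensate-density form: `|V|² n₀(a) ≥ Z · (|V|² n₀(b) + |V| − 2n)`. [folklore] -/
theorem condensateDensity_succ_ge (b a : (V → Fin 2) → ℝ) (n : ℝ) (hunit : ∑ ν, b ν ^ 2 = 1)
    (hsupp : ∀ ν, b ν ≠ 0 → ((univ.filter fun x => ν x = 0).card : ℝ) = n) :
    towerFidelity b a * ((Fintype.card V : ℝ) ^ 2 * condensateDensity b + ((Fintype.card V : ℝ) - 2 * n))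
      ≤ (Fintype.card V : ℝ) ^ 2 * condensateDensity a := by
  rcases isEmpty_or_nonempty V with hV | hV
  · have h0 : (Fintype.card V : ℝ) = 0 := by exact_mod_cast Fintype.card_eq_zero
    obtain ⟨ν, -, hν⟩ := Finset.exists_ne_zero_of_sum_ne_zero
      (show ∑ ν, b ν ^ 2 ≠ 0 by rw [hunit]; exact one_ne_zero)
    have hn : n = 0 := by
      have h1 := hsupp ν (fun h => hν (by simp [h]))
      have h2 : (univ.filter fun x => ν x = 0) = ∅ := by ext x; exact (IsEmpty.false x).elim
      rw [h2] at h1; simpa using h1.symm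
    simp [hn]
  · have hc : (0 : ℝ) < (Fintype.card V : ℝ) ^ 2 := by positivity
    have e1 : (Fintype.card V : ℝ) ^ 2 * condensateDensity b = lowerNormSq b := by
      unfold condensateDensity; field_simp
    have e2 : (Fintype.card V : ℝ) ^ 2 * condensateDensity a = lowerNormSq a := by
      unfold condensateDensity; field_simp
    rw [e1, e2]; exact lowerNormSq_succ_ge b a n hunit hsupp

/-- **REMOVAL FIDELITY** `Z₋(a → b) = ⟨b, B a⟩² / ‖B a‖²` (`cos²` of the angle between `B a` and the unit
vector `b`; junk `0` when `B a = 0`). [folklore] -/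
def removalFidelity (b a : (V → Fin 2) → ℝ) : ℝ := towerSum b a ^ 2 / lowerNormSq a

/-- **EXACT TOWER IDENTITY** `Z₊(b → a) · ‖B† b‖² = ⟨a, B† b⟩² = Z₋(a → b) · ‖B a‖²`; hence
`‖B a_{n+1}‖² / ‖B† a_n‖² = Z₊(n) / Z₋(n+1)` whenever both sides make sense. [folklore] -/
theorem towerFidelity_mul_eq_removalFidelity_mul (b a : (V → Fin 2) → ℝ) (hBa : lowerNormSq a ≠ 0) :
    towerFidelity b a * raiseNormSq b = removalFidelity b a * lowerNormSq a := by
  rw [← towerSum_sq_eq]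
  unfold removalFidelity
  field_simp

end Lattice

end Summit.HubbardSuperconductivity.HubbardSuperconductivity.Theorems.AnisotropyChord.Tower
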